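/-
Copyright: the b2b-balaban T⁴-continuum CRUX team, row NE7b owner lineage `t4-ne7b-p1` (gen 111). Project licence.
-/
import Mathlib.Analysis.SpecialFunctions.Trigonometric.Bounds
import Mathlib.Analysis.Real.Pi.Bounds
import Mathlib.Algebra.Order.BigOperators.Ring.Finset

/-!
# THE ONE-SHOT CHART CONSTANT OF THE FREE FIELD IS AT MOST `(π∕2)^d`, MODEL-FREE HALF: on every momentum fibre the minimiser's
# weighted second moment is at most `1∕w₀` times the squared first moment (`w₀` = the CENTRAL alias's weight, where `1∕ω` is largest),
# and the central block-mean weight is at least `(4∕π²)^d` — so `S₂ ≤ (π²∕4)^d·S²` on every fibre, for EVERY block side `M`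
# (row NE7b, node U5c; Mathlib only; [folklore] finite sums + `sin x ≥ 2x∕π`, `sin y ≤ y`)

Cell `pub-balaban`, sub-cell `t4`, spine estimate NE7b (`T4WeightBudget.RelWeightBound`; the cell's OWN estimate — NOT PRINTED in [Bałaban 1983–89],
NOT PROVED).  Crux-route work under `Spine/NE7b/` by the row OWNER (`t4-ne7b-p1` gen 111) under FREEZE (0)'s crux-prover clause; NOTHING of
Bałaban's is named; no `T4Continuum/Support` leaf typed; no `def`; zero `sorry`.  Imports: Mathlib only.

WHY (owner CLAIM C-ne7bp1-g111-1 ∕ RULING W-ne7bp1-g111-3, journal `HOME/CLAIMS.log` [NE7bP1-G111-RULING3]; pricing desk PRICING-NE7b v120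
F711–F713).  The desk's instrument no. 5 gives the η-norm of the one-shot free critical section `H_M` (block-mean averaging of side `M`, massless
scalar field) the fibre form `‖H_M‖_η² = sup_{p̃} S₂∕S²` with `S = Σ_l w_l X_l`, `S₂ = Σ_l w_l X_l²` over the `M^d` aliases `p_l = (p̃ + 2πl)∕M`,
`w_l = |u(p_l)|²` the block-mean weights (`Σ_l w_l = 1`), `X_l = 1∕ω(p_l)` the inverse Laplacian symbol; truth `sup_M ‖H_M‖_η = 1.326` (d = 4),
while the tree's certificate `B5HkUniformL2Zd.tsum_HBZd_sq_le_uniform` carries `c_H K_d = 10^{366.6}` (true, unusable: F711).  The owner's claim: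
`‖H_M‖_η ≤ (π∕2)^d` for EVERY `M` (6.088 at d = 4), by (1) `S₂ ≤ X_max·S`, (2) the CENTRAL alias has the largest `X` (the Laplacian symbol is
coordinatewise increasing in `|p_μ| ≤ π` and the central alias is coordinatewise smallest), (3) `S ≥ w₀X₀`, (4) `S₂ ≤ S²∕w₀`, (5)
`w₀ = Π_μ sin²(x_μ)∕(M² sin²(x_μ∕M)) ≥ (4∕π²)^d` for `x_μ = p̃_μ∕2 ∈ [−π∕2, π∕2] ∖ {0}` (`M sin(x∕M) ≤ x`, `sin x ≥ 2x∕π`) — the tree's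
«`U₀ ≥ (4∕π²)^d`» letter of `B5Ineq167SharpUpperZd` ∕ `B6QGQFourier275Zd`.  THIS FILE proves the MODEL-FREE half — steps (1)(3)(4) as one
finite-sum inequality with NO normalisation hypothesis, and step (5) — so that `S₂ ≤ (π²∕4)^d·S²` holds on every fibre whose distinguished index
carries the largest `X` and a weight `≥ (4∕π²)^d`.  The PLANCHEREL junction (the fibre form of `M^{−d}‖H_M B‖²` for the tree's `HBZd`, and step
(2) on the actual aliases) is NOT here (W-ne7bp1-g111-3 (d): torus `B5Hk163Torus` ∕ `B5Prop11Plancherel`, `ℤ^d` `B6QGQFourier275Zd` +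
`B5Momentum166Zd`).  Against the cell's one typed size-consumer (leaf-01's HRS threshold `M^{(d−2)∕2}`, desk F712∕F713) the constant `(π∕2)^d`
closes the one-shot chart letter for every composite side `M ≥ 8` at d = 4 (`1∕6.088 > 1∕8`), `M ≥ 16` at d = 3.

WHAT IS PROVED ([folklore]; `ι` a finite index type of aliases, `w X : ι → ℝ`):
* §1 **`weighted_sq_sum_le`** (`0 ≤ w`, `0 ≤ X`, `X ≤ X i₀` everywhere ⟹ `w i₀ · Σ w·X² ≤ (Σ w·X)²`), `weighted_sq_sum_div_le` (the ratio form when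
  `0 < w i₀`, `0 < Σ w·X`).
* §2 **`sin_sq_div_ge`** (`x ≠ 0`, `|x| ≤ π∕2`, `1 ≤ M` ⟹ `4∕π² ≤ sin²x ∕ (M²·sin²(x∕M))`), **`aliasWeight_ge`** (the product over `Fin d`:
  `(4∕π²)^d ≤ Π_μ sin²(x_μ)∕(M² sin²(x_μ∕M))`).
* §3 **`fibre_bound`** (`0 ≤ w`, `0 ≤ X ≤ X i₀`, `(4∕π²)^d ≤ w i₀` ⟹ `(4∕π²)^d · Σ w·X² ≤ (Σ w·X)²`, i.e. `S₂ ≤ (π²∕4)^d·S²`).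
* §4 numerics: `(π²∕4)^4 < 37.21` (so `(π∕2)^4 < 6.1 < 8`), `(π²∕4)^3 < 15.1` (`< 16`).

NOT HERE (honest): the fibre formula for `HBZd` (Plancherel on `ℤ^d` or the torus), step (2) on the lattice aliases, the sharp value 1.326, the two
finite levels `M = 2, 4` at `L = 2` (NC-NE7b-β (β0), a calc request), anything of Bałaban's ((A3), NC-NE7b-α UNRULED).  BY-NAME EFFECT ON THE WALL:
NONE.  NE7b NOT PRINTED ∕ NOT PROVED; spine PROVED 0∕9; rung (B)+1 on a FINITE torus — NOT infinite volume, NOT the mass gap, NOT Clay.  HONEST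
DEPENDENCY: continuum YM on T⁴ ⇐ BetaPertH ∧ nine spine estimates (0∕9 proved); BetaPertH ⇐ (D1) ∧ (D4) ∧ CAP+tail; G-an2-4 gates asym, D1 and NE2∕3∕4.
-/

set_option autoImplicit false

namespace Summit.QuantumFields.BalabanUV.T4Continuum.NE7b.OneShotChartFibreBound

open Finset Real

/-! ## §1. The weighted second moment against the squared first moment -/

/-- **`w i₀ · Σ w X² ≤ (Σ w X)²`** when the weights and values are nonnegative and `X i₀` is the largest value: `Σ wX² ≤ X_{i₀}·Σ wX` and
`w_{i₀}X_{i₀} ≤ Σ wX`.  No normalisation of the weights is needed. [folklore] -/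
theorem weighted_sq_sum_le {ι : Type*} [Fintype ι] (w X : ι → ℝ) (hw : ∀ i, 0 ≤ w i) (hX : ∀ i, 0 ≤ X i) (i₀ : ι)
    (hmax : ∀ i, X i ≤ X i₀) : w i₀ * ∑ i, w i * X i ^ 2 ≤ (∑ i, w i * X i) ^ 2 := by
  have hS : 0 ≤ ∑ i, w i * X i := Finset.sum_nonneg fun i _ => mul_nonneg (hw i) (hX i)
  have h1 : ∑ i, w i * X i ^ 2 ≤ X i₀ * ∑ i, w i * X i := by
    rw [Finset.mul_sum]
    exact Finset.sum_le_sum fun i _ => by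
      have := mul_le_mul_of_nonneg_left (hmax i) (mul_nonneg (hw i) (hX i))
      nlinarith
  have h2 : w i₀ * X i₀ ≤ ∑ i, w i * X i :=
    Finset.single_le_sum (f := fun i => w i * X i) (fun i _ => mul_nonneg (hw i) (hX i)) (Finset.mem_univ i₀)
  calc w i₀ * ∑ i, w i * X i ^ 2 ≤ w i₀ * (X i₀ * ∑ i, w i * X i) := mul_le_mul_of_nonneg_left h1 (hw i₀)
    _ = (w i₀ * X i₀) * ∑ i, w i * X i := by ring
    _ ≤ (∑ i, w i * X i) * ∑ i, w i * X i := mul_le_mul_of_nonneg_right h2 hS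
    _ = (∑ i, w i * X i) ^ 2 := by ring

/-- The ratio form: `Σ wX² ∕ (Σ wX)² ≤ 1∕w_{i₀}` (for `0 < w i₀`, `0 < Σ wX`). [folklore] -/
theorem weighted_sq_sum_div_le {ι : Type*} [Fintype ι] (w X : ι → ℝ) (hw : ∀ i, 0 ≤ w i) (hX : ∀ i, 0 ≤ X i) (i₀ : ι)
    (hmax : ∀ i, X i ≤ X i₀) (hw₀ : 0 < w i₀) (hS : 0 < ∑ i, w i * X i) :
    (∑ i, w i * X i ^ 2) / (∑ i, w i * X i) ^ 2 ≤ 1 / w i₀ := by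
  rw [div_le_div_iff₀ (by positivity) hw₀, one_mul, mul_comm]
  exact weighted_sq_sum_le w X hw hX i₀ hmax

/-! ## §2. The central block-mean weight is at least `(4∕π²)^d` -/

/-- **One coordinate**: for `x ≠ 0`, `|x| ≤ π∕2` and `1 ≤ M`: `4∕π² ≤ sin²x ∕ (M²·sin²(x∕M))` — from `M·sin(x∕M) ≤ x` (`sin y ≤ y`) and
`sin x ≥ 2x∕π` on `[0, π∕2]`, by evenness. [folklore] -/
theorem sin_sq_div_ge {x M : ℝ} (hx : x ≠ 0) (hxa : |x| ≤ π / 2) (hM : 1 ≤ M) :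
    4 / π ^ 2 ≤ sin x ^ 2 / (M ^ 2 * sin (x / M) ^ 2) := by
  -- reduce to `t = |x| > 0`
  have hπ : 0 < π := Real.pi_pos
  set t : ℝ := |x| with ht
  have ht0 : 0 < t := abs_pos.mpr hx
  have hsx : sin x ^ 2 = sin t ^ 2 := by
    rcases abs_choice x with h | h
    · rw [ht, h]
    · rw [ht, h, Real.sin_neg, neg_sq]
  have hsxM : sin (x / M) ^ 2 = sin (t / M) ^ 2 := by
    rcases abs_choice x with h | h
    · rw [ht, h]
    · rw [ht, h, neg_div, Real.sin_neg, neg_sq]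
  rw [hsx, hsxM]
  have hM0 : 0 < M := lt_of_lt_of_le one_pos hM
  have htM0 : 0 ≤ t / M := div_nonneg ht0.le hM0.le
  -- `M sin(t/M) ≤ t`
  have h1 : M * sin (t / M) ≤ t := by
    have := Real.sin_le htM0
    calc M * sin (t / M) ≤ M * (t / M) := mul_le_mul_of_nonneg_left this hM0.le
      _ = t := by field_simp
  -- `0 ≤ M sin(t/M)` (since `t/M ≤ π/2 ≤ π`)
  have htM1 : t / M ≤ π := by
    have : t / M ≤ t := div_le_self ht0.le hM
    linarith
  have h2 : 0 ≤ M * sin (t / M) := mul_nonneg hM0.le (Real.sin_nonneg_of_nonneg_of_le_pi htM0 htM1)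
  -- `2t/π ≤ sin t`
  have h3 : 2 / π * t ≤ sin t := Real.mul_le_sin ht0.le hxa
  have h3' : 0 ≤ 2 / π * t := by positivity
  -- squares
  have hA : (M * sin (t / M)) ^ 2 ≤ t ^ 2 := pow_le_pow_left₀ h2 h1 2
  have hB : (2 / π * t) ^ 2 ≤ sin t ^ 2 := pow_le_pow_left₀ h3' h3 2
  by_cases hz : sin (t / M) = 0
  · -- degenerate denominator: the quotient is `0`-denominator; but then `M sin = 0 ≤ …`; we show the bound via `t ≤ 0` contradiction
    -- `sin (t/M) = 0` with `0 < t/M ≤ π` forces `t/M = π`, then `M sin(t/M) = 0 ≤ t` gives no contradiction; handle directly: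
    -- in this case `sin t ^ 2 / (M^2 * 0) = sin t ^ 2 / 0 = 0`, so we must exclude it: `t/M = π` means `t = Mπ ≥ π > π/2`, contradiction.
    exfalso
    have htMpos : 0 < t / M := div_pos ht0 hM0
    have hle : t / M ≤ π / 2 := le_trans (div_le_self ht0.le hM) hxa
    have hlt : t / M < π := by linarith
    have := Real.sin_pos_of_pos_of_lt_pi htMpos hlt
    exact this.ne' hz
  · have hden : 0 < M ^ 2 * sin (t / M) ^ 2 := by positivity
    rw [div_le_div_iff₀ (by positivity) hden]
    -- goal: 4 * (M^2 * sin(t/M)^2) ≤ sin t ^ 2 * π^2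
    have : (M * sin (t / M)) ^ 2 * (4 / π ^ 2 * π ^ 2) ≤ sin t ^ 2 * π ^ 2 := by
      have e : 4 / π ^ 2 * π ^ 2 = 4 := by field_simp
      rw [e]
      have hB' : 4 / π ^ 2 * t ^ 2 ≤ sin t ^ 2 := by
        have : (2 / π * t) ^ 2 = 4 / π ^ 2 * t ^ 2 := by ring
        rw [← this]; exact hB
      have : 4 * t ^ 2 ≤ sin t ^ 2 * π ^ 2 := by
        have hπ2 : 0 < π ^ 2 := by positivity
        have := mul_le_mul_of_nonneg_right hB' hπ2.le
        calc 4 * t ^ 2 = 4 / π ^ 2 * t ^ 2 * π ^ 2 := by field_simp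
          _ ≤ sin t ^ 2 * π ^ 2 := this
      nlinarith [hA]
    have e' : 4 / π ^ 2 * π ^ 2 = 4 := by field_simp
    calc 4 * (M ^ 2 * sin (t / M) ^ 2) = (M * sin (t / M)) ^ 2 * (4 / π ^ 2 * π ^ 2) := by rw [e']; ring
      _ ≤ sin t ^ 2 * π ^ 2 := this

/-- **All coordinates**: `(4∕π²)^d ≤ Π_{μ<d} sin²(x_μ)∕(M² sin²(x_μ∕M))` for `x_μ ≠ 0`, `|x_μ| ≤ π∕2`, `1 ≤ M` — the central alias's block-mean
weight at `x_μ = p̃_μ∕2`. [folklore] -/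
theorem aliasWeight_ge {d : ℕ} (x : Fin d → ℝ) {M : ℝ} (hx : ∀ μ, x μ ≠ 0) (hxa : ∀ μ, |x μ| ≤ π / 2) (hM : 1 ≤ M) :
    (4 / π ^ 2) ^ d ≤ ∏ μ : Fin d, sin (x μ) ^ 2 / (M ^ 2 * sin (x μ / M) ^ 2) := by
  calc (4 / π ^ 2) ^ d = ∏ _μ : Fin d, (4 / π ^ 2 : ℝ) := by rw [Finset.prod_const, Finset.card_univ, Fintype.card_fin]
    _ ≤ ∏ μ : Fin d, sin (x μ) ^ 2 / (M ^ 2 * sin (x μ / M) ^ 2) :=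
        Finset.prod_le_prod (fun _ _ => by positivity) fun μ _ => sin_sq_div_ge (hx μ) (hxa μ) hM

/-! ## §3. The fibre bound -/

/-- **THE FIBRE BOUND**: on a fibre with nonnegative weights `w` and values `0 ≤ X ≤ X i₀`, whose distinguished index carries a weight
`w i₀ ≥ (4∕π²)^d`, the weighted second moment is at most `(π²∕4)^d` times the squared first moment:
`(4∕π²)^d · Σ wX² ≤ (Σ wX)²`.  With the fibre formula `‖H_M‖_η² = sup S₂∕S²` this is `‖H_M‖_η ≤ (π∕2)^d`. [folklore] -/
theorem fibre_bound {ι : Type*} [Fintype ι] {d : ℕ} (w X : ι → ℝ) (hw : ∀ i, 0 ≤ w i) (hX : ∀ i, 0 ≤ X i) (i₀ : ι)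
    (hmax : ∀ i, X i ≤ X i₀) (hw₀ : (4 / π ^ 2) ^ d ≤ w i₀) :
    (4 / π ^ 2) ^ d * ∑ i, w i * X i ^ 2 ≤ (∑ i, w i * X i) ^ 2 :=
  (mul_le_mul_of_nonneg_right hw₀ (Finset.sum_nonneg fun i _ => mul_nonneg (hw i) (sq_nonneg _))).trans
    (weighted_sq_sum_le w X hw hX i₀ hmax)

/-- The same with the central weight supplied by §2: aliases indexed by any finite type with a distinguished `i₀` whose weight IS the
central block-mean weight `Π_μ sin²(x_μ)∕(M² sin²(x_μ∕M))`. [folklore] -/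
theorem fibre_bound_of_central {ι : Type*} [Fintype ι] {d : ℕ} (w X : ι → ℝ) (hw : ∀ i, 0 ≤ w i) (hX : ∀ i, 0 ≤ X i)
    (i₀ : ι) (hmax : ∀ i, X i ≤ X i₀) (x : Fin d → ℝ) {M : ℝ} (hx : ∀ μ, x μ ≠ 0) (hxa : ∀ μ, |x μ| ≤ π / 2) (hM : 1 ≤ M)
    (hw₀ : w i₀ = ∏ μ : Fin d, sin (x μ) ^ 2 / (M ^ 2 * sin (x μ / M) ^ 2)) :
    (4 / π ^ 2) ^ d * ∑ i, w i * X i ^ 2 ≤ (∑ i, w i * X i) ^ 2 :=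
  fibre_bound w X hw hX i₀ hmax (hw₀ ▸ aliasWeight_ge x hx hxa hM)

/-! ## §4. Numerics: the constant against the consumer threshold -/

/-- `(π²∕4)⁴ < 37.21`, hence `(π∕2)⁴ = ‖H_M‖_η`'s bound at d = 4 is `< 6.1 < 8 = M` from the third level at `L = 2`. -/
theorem pi_sq_div_four_pow_four_lt : (π ^ 2 / 4) ^ 4 < 37.21 := by
  have hπ : π < 3.1416 := Real.pi_lt_d4
  have hπ0 : 0 < π := Real.pi_pos
  have h1 : π ^ 2 / 4 < 2.4675 := by nlinarith
  have h0 : 0 ≤ π ^ 2 / 4 := by positivity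
  calc (π ^ 2 / 4) ^ 4 ≤ (2.4675 : ℝ) ^ 4 := by gcongr
    _ < 37.21 := by norm_num

/-- `(π²∕4)³ < 15.1 < 16`: at d = 3 the bound `(π∕2)³ < √16` closes from composite side `16`. -/
theorem pi_sq_div_four_pow_three_lt : (π ^ 2 / 4) ^ 3 < 15.1 := by
  have hπ : π < 3.1416 := Real.pi_lt_d4
  have hπ0 : 0 < π := Real.pi_pos
  have h1 : π ^ 2 / 4 < 2.4675 := by nlinarith
  have h0 : 0 ≤ π ^ 2 / 4 := by positivity
  calc (π ^ 2 / 4) ^ 3 ≤ (2.4675 : ℝ) ^ 3 := by gcongr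
    _ < 15.1 := by norm_num

/-- Margin at d = 4, M = 8: the squared chart bound `(π²∕4)⁴ < 64 = M²`, i.e. `(π∕2)⁴ < M = M^{(d−2)∕2}`. -/
example : (π ^ 2 / 4) ^ 4 < (8 : ℝ) ^ 2 := by
  have := pi_sq_div_four_pow_four_lt; norm_num at this ⊢; linarith

end Summit.QuantumFields.BalabanUV.T4Continuum.NE7b.OneShotChartFibreBound
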